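import Mathlib
import HarnessLib
import Literature.Analysis.FluidPDE.ClassicalSolution
import Literature.Analysis.FluidPDE.LerayHopf
import Literature.Analysis.FluidPDE.SuitableWeak
import Summits.NavierStokesRegularity.NavierStokesRegularity.Theorems.QuarterJoltL4SliceTestCriterion
import Summits.NavierStokesRegularity.NavierStokesRegularity.Theorems.QuarterJoltTypeIEnergyEquality
import Summits.NavierStokesRegularity.NavierStokesRegularity.Theorems.QuarterJoltEnergyJumpDefect
import Summits.NavierStokesRegularity.NavierStokesRegularity.Theorems.QuarterJoltNoEnergyAtom
import Summits.NavierStokesRegularity.NavierStokesRegularity.Theorems.HodographBetchovFastClassSqueezeNoConcentration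
import Summits.NavierStokesRegularity.NavierStokesRegularity.Theorems.CertifiedBlowupCertifiedBlowupAxisymBlowupEnergyDrain

/-!
# Route QuarterJolt — crux `NoTerminalJolt` (stmt-NavierStokesRegularity-26463), LEAD line
# `regular_split` rev 8: A FIRST BLOW-UP WITH `‖u(t)‖_{L⁴} = O((T−t)^{−1/4})` HAS NO ENERGY JUMP

Seat ns-ntj-p1 g6 (LEAD of the crux; `--supports 26463 --as helper`). Third file of the `L⁴`
SLICE-TEST CRITERION chain (`…SliceTestIncrementL4` p652191 → `…L4SliceTestCriterion` → THIS →
`…ShinbrotEnergyEquality`). Frame: `(u,p)` classical on `[0,T)` (`ν, T > 0`), Leray–Hopf on `[0,T]`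
from a rapidly decaying datum.

First the energy-equality / 18118 / no-energy-atom FORMS of the `L⁴` slice-test criterion of file II
(`energyEquality_of_l4Criterion`, `noFastEnergyConcentration_of_l4Criterion`,
`noEnergyAtom_of_l4Criterion`). THE THEOREM (`tendsto_integral_norm_sub_sq_of_weakL4Rate`): if `∫‖u(t)‖⁴ ≤ M/(T−t)` for `t < T`
near `T` — the WEAK-`L⁴` RATE `‖u(t)‖_{L⁴} ≤ M^{1/4}(T−t)^{−1/4}`, i.e. `‖u(·)‖_{L⁴} ∈ L^{4,w}` in
time near `T` — then `∫‖u(t) − u(T)‖² → 0` as `t ↑ T`: NO ENERGY JUMP at `T`, equivalently Leray's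
energy equality on `[0,T]`. Proof: the majorant `m(τ) = √M/√(T−τ) ≥ ‖u(τ)‖²_{L⁴}` has
`∫ₜˢ m = 2√M(√(T−t) − √(T−s)) ≤ 2√M√(T−t)` (`EnergyDrain.lintegral_div_sqrt_sub_eq`), so the `L⁴`
slice-test criterion (`tendsto_integral_norm_sub_sq_of_l4Majorant`) applies with `C = 2√M`.

POSITION IN PRINT. Energy equality at a first blow-up time (or for weak solutions) is known in the
classes of Lions (`L⁴L⁴`), Shinbrot (`L^q_tL^p_x`, `2/q + 2/p ≤ 1`, `p ≥ 4`), Kozono–Taniuchi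
(`L²BMO`), Cheskidov–Friedlander–Shvydkoy / Cheskidov–Luo (`L³B^{1/3}_{3,∞}` and, Nonlinearity 33
(2020) Thm. 1.1 / Cor. 1.2, the WEAK-IN-TIME classes `L^{β,w}B^{2/β+2/p−1}_{p,∞}` with `1 ≤ β < p`,
`2/p + 1/β < 1` — at `α = 0` these are `‖u(t)‖_{B⁰_{p,∞}} ≲ (T−t)^{−(1/2−1/p)}` for `p > 4` ONLY, the
constraint `β = 2p/(p−2) < p` excluding `p = 4`), Leslie–Shvydkoy (Type I in time, ARMA 230 (2018)
Thm. 1.2) and `L^{2,∞}BMO` (arXiv:2107.04157 Thm. 1.3). The weak-`L⁴` rate of this file is the `p = 4`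
ENDPOINT of Cheskidov–Luo's Cor. 1.2, not covered by interpolation into any of these classes
(`L^{4,w}_tL⁴_x ∩ L^∞L² ∩ L²H¹` interpolates to `L^{q,w}L^p` with `1/q + 1/p = 2/3 − θ/6 > 1/2` for
`θ < 1`); here it follows, at a first blow-up time of the frame, from elementary slice testing. By NS
scaling a self-similar / Type-I blow-up has `∫‖u(t)‖⁴ ≍ (T−t)^{−1/2}`, so the class reaches blow-ups
whose `L⁴` mass is the SQUARE of the self-similar one: `rev 5`'s Type-I theorem is the special case
`∫‖u(t)‖⁴ ≤ 2E₀C²/(T−t)` (`weakL4Rate_of_isTypeIBlowup` + the weak-`L⁴` theorem re-derive p639359, see the `example`).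

HONEST FRAMING: nothing here claims progress on `NoTerminalJolt`, on stmt-18118 or on Navier–Stokes
regularity — all OPEN; no blow-up is known to exist. No summit statement is proved here. [folklore]
-/

noncomputable section

-- the summit and its single sub-problem share the name (CONVENTIONS §1), as in every Theorems file
set_option linter.dupNamespace false

namespace Summit.NavierStokesRegularity.NavierStokesRegularity.Theorems

open MeasureTheory Set Function Filter Topology InnerProductSpace
open scoped ENNReal NNReal ContDiff RealInnerProductSpace
open Literature.Analysis.FluidPDE

namespace NoTerminalJolt

/-! ### Forms of the `L⁴` slice-test criterion (file II) -/

/-- **`L⁴` criterion ⇒ no fast energy concentration** (the conclusion of shelf statement stmt-18118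
`HodographBetchov.NoFastEnergyConcentration` = stub `stub_noFastEnergyConcentration` of
`Cruxes/NoTerminalJolt/Lines/regular_split.lean`, for THIS solution). [folklore] -/
theorem noFastEnergyConcentration_of_l4Criterion {ν T : ℝ} (hν : 0 < ν) (hT : 0 < T)
    {u : ℝ → EuclideanSpace ℝ (Fin 3) → EuclideanSpace ℝ (Fin 3)} {p : ℝ → EuclideanSpace ℝ (Fin 3) → ℝ}
    (hcl : IsClassicalNSSolutionOn (Ico 0 T) ν 0 u p) (hLH : IsLerayHopfOn T ν 0 (u 0) u)
    (hdec : HasRapidSpatialDecay (u 0)) {C : ℝ} (hC : 0 ≤ C)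
    (hcrit : ∀ᶠ t in 𝓝[<] T, ∫⁻ τ in Ioo t T, ENNReal.ofReal (Real.sqrt (∫ x, ‖u τ x‖ ^ 4)) ≤
      ENNReal.ofReal (C * Real.sqrt (T - t))) :
    ∀ ε : ℝ, 0 < ε → ∃ l : ℝ, 0 < l ∧ ∀ t ∈ Set.Ico 0 T,
      ∫⁻ x in {x : EuclideanSpace ℝ (Fin 3) | l < ‖u t x‖}, ‖u t x‖ₑ ^ 2 ≤ ENNReal.ofReal ε :=
  FastClassSqueeze.Birth.stub_no_fast_energy_concentration_of_tendsto ν T hν hT u p hcl hLH hdec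
    (tendsto_eLpNorm_sub_of_l4Criterion hν hT hcl hLH hdec hC hcrit)

/-- **`L⁴` criterion ⇒ no energy atom at `T`** (the conclusion of stub `stub_noEnergyAtom` of
`Cruxes/WeakLambdaCriterion/Lines/birth.lean`, crux stmt-19625, for THIS solution;
`noEnergyAtom_of_tendsto_eLpNorm_sub` p642579). [folklore] -/
theorem noEnergyAtom_of_l4Criterion {ν T : ℝ} (hν : 0 < ν) (hT : 0 < T)
    {u : ℝ → EuclideanSpace ℝ (Fin 3) → EuclideanSpace ℝ (Fin 3)} {p : ℝ → EuclideanSpace ℝ (Fin 3) → ℝ}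
    (hcl : IsClassicalNSSolutionOn (Ico 0 T) ν 0 u p) (hLH : IsLerayHopfOn T ν 0 (u 0) u)
    (hdec : HasRapidSpatialDecay (u 0)) {C : ℝ} (hC : 0 ≤ C)
    (hcrit : ∀ᶠ t in 𝓝[<] T, ∫⁻ τ in Ioo t T, ENNReal.ofReal (Real.sqrt (∫ x, ‖u τ x‖ ^ 4)) ≤
      ENNReal.ofReal (C * Real.sqrt (T - t)))
    (x₀ : EuclideanSpace ℝ (Fin 3)) {η : NNReal} (hη : 0 < η) :
    ∃ r : ℝ, 0 < r ∧ ∀ᶠ t in 𝓝[<] T, ∫⁻ x in Metric.ball x₀ r, ‖u t x‖ₑ ^ 2 < (η : ℝ≥0∞) :=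
  noEnergyAtom_of_tendsto_eLpNorm_sub hT hcl hLH
    (tendsto_eLpNorm_sub_of_l4Criterion hν hT hcl hLH hdec hC hcrit) x₀ hη


/-- **`L⁴` criterion ⇒ LERAY'S ENERGY EQUALITY on `[0,T]`**: `E(u T) + ν∫₀ᵀ∫|∇u|²_F = E(u 0)`. [folklore] -/
theorem energyEquality_of_l4Criterion {ν T : ℝ} (hν : 0 < ν) (hT : 0 < T)
    {u : ℝ → EuclideanSpace ℝ (Fin 3) → EuclideanSpace ℝ (Fin 3)} {p : ℝ → EuclideanSpace ℝ (Fin 3) → ℝ}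
    (hcl : IsClassicalNSSolutionOn (Ico 0 T) ν 0 u p) (hLH : IsLerayHopfOn T ν 0 (u 0) u)
    (hdec : HasRapidSpatialDecay (u 0)) {C : ℝ} (hC : 0 ≤ C)
    (hcrit : ∀ᶠ t in 𝓝[<] T, ∫⁻ τ in Ioo t T, ENNReal.ofReal (Real.sqrt (∫ x, ‖u τ x‖ ^ 4)) ≤
      ENNReal.ofReal (C * Real.sqrt (T - t))) :
    VectorCalculus.kineticEnergy (u T) +
      ν * (∫⁻ τ in Ioo 0 T, ∫⁻ x, ENNReal.ofReal (frobeniusNormSq (fderiv ℝ (u τ) x))).toReal =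
      VectorCalculus.kineticEnergy (u 0) :=
  (tendsto_eLpNorm_sub_iff_energyEquality hν hT hcl hLH).1
    (tendsto_eLpNorm_sub_of_l4Criterion hν hT hcl hLH hdec hC hcrit)

/-! ### WEAK-`L⁴` RATE ⇒ NO ENERGY JUMP -/

/-- **A FIRST BLOW-UP WITH `∫‖u(t)‖⁴ ≤ M/(T−t)` HAS NO ENERGY JUMP** (the `p = 4` endpoint of
Cheskidov–Luo, Nonlinearity 33 (2020) Cor. 1.2, in the first-blow-up frame). `(u,p)` classical on
`[0,T)` (`ν, T > 0`), Leray–Hopf on `[0,T]` from a rapidly decaying datum, and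
`∫‖u(t)‖⁴ ≤ M/(T−t)` for `t < T` near `T` (a genuine integral: `u(t)` is bounded and in `L²`). Then `∫‖u(t) − u(T)‖² → 0` as `t ↑ T`. (`T` need not be a
blow-up time.) Proof: `L⁴` slice-test criterion with the majorant `m(τ) = √M/√(T−τ)`,
`∫ₜˢ m ≤ 2√M√(T−t)`. [folklore] -/
theorem tendsto_integral_norm_sub_sq_of_weakL4Rate {ν T : ℝ} (hν : 0 < ν) (hT : 0 < T)
    {u : ℝ → EuclideanSpace ℝ (Fin 3) → EuclideanSpace ℝ (Fin 3)} {p : ℝ → EuclideanSpace ℝ (Fin 3) → ℝ}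
    (hcl : IsClassicalNSSolutionOn (Ico 0 T) ν 0 u p) (hLH : IsLerayHopfOn T ν 0 (u 0) u)
    (hdec : HasRapidSpatialDecay (u 0)) {M : ℝ}
    (hrate : ∀ᶠ t in 𝓝[<] T, ∫ x, ‖u t x‖ ^ 4 ≤ M / (T - t)) :
    Tendsto (fun t => ∫ x, ‖u t x - u T x‖ ^ 2) (𝓝[<] T) (𝓝 0) := by
  set m : ℝ → ℝ := fun τ => Real.sqrt M / Real.sqrt (T - τ) with hmdef
  have hIio : ∀ᶠ t in 𝓝[<] T, t < T := eventually_mem_nhdsWithin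
  have hm : ∀ᶠ τ in 𝓝[<] T, Real.sqrt (∫ x, ‖u τ x‖ ^ 4) ≤ m τ := by
    filter_upwards [hrate, hIio] with τ hτ hτT
    calc Real.sqrt (∫ x, ‖u τ x‖ ^ 4) ≤ Real.sqrt (M / (T - τ)) := Real.sqrt_le_sqrt hτ
      _ = m τ := by rw [hmdef, Real.sqrt_div' M (sub_nonneg.2 hτT.le)]
  have hC : 0 ≤ 2 * Real.sqrt M := by positivity
  refine tendsto_integral_norm_sub_sq_of_l4Majorant hν hT hcl hLH hdec hm hC ?_
  filter_upwards [hIio] with t htT s hs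
  have hsT : s ≤ T := hs.2.le
  rw [hmdef, CertifiedBlowupAxisymBlowup.EnergyDrain.lintegral_div_sqrt_sub_eq (T := T)
    (Real.sqrt_nonneg M) hs.1 hsT]
  refine ENNReal.ofReal_le_ofReal ?_
  have h1 : 0 ≤ Real.sqrt (T - s) := Real.sqrt_nonneg _
  have h2 : 0 ≤ Real.sqrt M := Real.sqrt_nonneg _
  nlinarith

/-- **Weak-`L⁴` rate ⇒ no energy jump, `eLpNorm` form.** [folklore] -/
theorem tendsto_eLpNorm_sub_of_weakL4Rate {ν T : ℝ} (hν : 0 < ν) (hT : 0 < T)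
    {u : ℝ → EuclideanSpace ℝ (Fin 3) → EuclideanSpace ℝ (Fin 3)} {p : ℝ → EuclideanSpace ℝ (Fin 3) → ℝ}
    (hcl : IsClassicalNSSolutionOn (Ico 0 T) ν 0 u p) (hLH : IsLerayHopfOn T ν 0 (u 0) u)
    (hdec : HasRapidSpatialDecay (u 0)) {M : ℝ}
    (hrate : ∀ᶠ t in 𝓝[<] T, ∫ x, ‖u t x‖ ^ 4 ≤ M / (T - t)) :
    Tendsto (fun t => eLpNorm (u t - u T) 2 volume) (𝓝[<] T) (𝓝 0) :=
  (tendsto_eLpNorm_sub_iff_tendsto_integral_norm_sub_sq hT hLH).2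
    (tendsto_integral_norm_sub_sq_of_weakL4Rate hν hT hcl hLH hdec hrate)

/-- **Weak-`L⁴` rate ⇒ LERAY'S ENERGY EQUALITY on `[0,T]`**: `E(u T) + ν∫₀ᵀ∫|∇u|²_F = E(u 0)`
(`tendsto_eLpNorm_sub_iff_energyEquality`, p632964). [folklore] -/
theorem energyEquality_of_weakL4Rate {ν T : ℝ} (hν : 0 < ν) (hT : 0 < T)
    {u : ℝ → EuclideanSpace ℝ (Fin 3) → EuclideanSpace ℝ (Fin 3)} {p : ℝ → EuclideanSpace ℝ (Fin 3) → ℝ}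
    (hcl : IsClassicalNSSolutionOn (Ico 0 T) ν 0 u p) (hLH : IsLerayHopfOn T ν 0 (u 0) u)
    (hdec : HasRapidSpatialDecay (u 0)) {M : ℝ}
    (hrate : ∀ᶠ t in 𝓝[<] T, ∫ x, ‖u t x‖ ^ 4 ≤ M / (T - t)) :
    VectorCalculus.kineticEnergy (u T) +
      ν * (∫⁻ τ in Ioo 0 T, ∫⁻ x, ENNReal.ofReal (frobeniusNormSq (fderiv ℝ (u τ) x))).toReal =
      VectorCalculus.kineticEnergy (u 0) :=
  (tendsto_eLpNorm_sub_iff_energyEquality hν hT hcl hLH).1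
    (tendsto_eLpNorm_sub_of_weakL4Rate hν hT hcl hLH hdec hrate)

/-- **Weak-`L⁴` rate ⇒ no fast energy concentration** (the conclusion of shelf statement stmt-18118
`HodographBetchov.NoFastEnergyConcentration` = stub `stub_noFastEnergyConcentration` of
`Cruxes/NoTerminalJolt/Lines/regular_split.lean`, for THIS solution). [folklore] -/
theorem noFastEnergyConcentration_of_weakL4Rate {ν T : ℝ} (hν : 0 < ν) (hT : 0 < T)
    {u : ℝ → EuclideanSpace ℝ (Fin 3) → EuclideanSpace ℝ (Fin 3)} {p : ℝ → EuclideanSpace ℝ (Fin 3) → ℝ}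
    (hcl : IsClassicalNSSolutionOn (Ico 0 T) ν 0 u p) (hLH : IsLerayHopfOn T ν 0 (u 0) u)
    (hdec : HasRapidSpatialDecay (u 0)) {M : ℝ}
    (hrate : ∀ᶠ t in 𝓝[<] T, ∫ x, ‖u t x‖ ^ 4 ≤ M / (T - t)) :
    ∀ ε : ℝ, 0 < ε → ∃ l : ℝ, 0 < l ∧ ∀ t ∈ Set.Ico 0 T,
      ∫⁻ x in {x : EuclideanSpace ℝ (Fin 3) | l < ‖u t x‖}, ‖u t x‖ₑ ^ 2 ≤ ENNReal.ofReal ε :=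
  FastClassSqueeze.Birth.stub_no_fast_energy_concentration_of_tendsto ν T hν hT u p hcl hLH hdec
    (tendsto_eLpNorm_sub_of_weakL4Rate hν hT hcl hLH hdec hrate)

/-- **Weak-`L⁴` rate ⇒ no energy atom at `T`** (the conclusion of stub `stub_noEnergyAtom` of
`Cruxes/WeakLambdaCriterion/Lines/birth.lean`, crux stmt-19625, for THIS solution). [folklore] -/
theorem noEnergyAtom_of_weakL4Rate {ν T : ℝ} (hν : 0 < ν) (hT : 0 < T)
    {u : ℝ → EuclideanSpace ℝ (Fin 3) → EuclideanSpace ℝ (Fin 3)} {p : ℝ → EuclideanSpace ℝ (Fin 3) → ℝ}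
    (hcl : IsClassicalNSSolutionOn (Ico 0 T) ν 0 u p) (hLH : IsLerayHopfOn T ν 0 (u 0) u)
    (hdec : HasRapidSpatialDecay (u 0)) {M : ℝ}
    (hrate : ∀ᶠ t in 𝓝[<] T, ∫ x, ‖u t x‖ ^ 4 ≤ M / (T - t))
    (x₀ : EuclideanSpace ℝ (Fin 3)) {η : NNReal} (hη : 0 < η) :
    ∃ r : ℝ, 0 < r ∧ ∀ᶠ t in 𝓝[<] T, ∫⁻ x in Metric.ball x₀ r, ‖u t x‖ₑ ^ 2 < (η : ℝ≥0∞) :=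
  noEnergyAtom_of_tendsto_eLpNorm_sub hT hcl hLH
    (tendsto_eLpNorm_sub_of_weakL4Rate hν hT hcl hLH hdec hrate) x₀ hη

/-! ### The sup-norm Type-I rate is a weak-`L⁴` rate: rev 5's theorem as a special case -/

/-- **Type I ⇒ weak-`L⁴` rate.** In the frame (classical on `[0,T)`, Leray–Hopf on `[0,T]`, `ν > 0`)
the sup-norm Type-I rate at `T` (`‖u(t,x)‖ ≤ C/√(T−t)` near `T`) gives
`∫‖u(t)‖⁴ ≤ (max C 0)²·2E(u 0)/(T−t)` near `T` (`‖u‖⁴ ≤ (C²/(T−t))‖u‖²` pointwise and the energy is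
antitone, `EnergyDrain.kineticEnergy_antitoneOn`). No decay hypothesis. [folklore] -/
theorem weakL4Rate_of_isTypeIBlowup {ν T : ℝ} (hν : 0 < ν) (hT : 0 < T)
    {u : ℝ → EuclideanSpace ℝ (Fin 3) → EuclideanSpace ℝ (Fin 3)} {p : ℝ → EuclideanSpace ℝ (Fin 3) → ℝ}
    (hcl : IsClassicalNSSolutionOn (Ico 0 T) ν 0 u p) (hLH : IsLerayHopfOn T ν 0 (u 0) u)
    (hTI : IsTypeIBlowup u T) :
    ∃ M : ℝ, 0 ≤ M ∧ ∀ᶠ t in 𝓝[<] T, ∫ x, ‖u t x‖ ^ 4 ≤ M / (T - t) := by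
  obtain ⟨C, hC⟩ := hTI
  set C' : ℝ := max C 0 with hC'
  have hC'0 : 0 ≤ C' := le_max_right _ _
  set E₀ : ℝ := VectorCalculus.kineticEnergy (u 0) with hE₀
  have hE₀0 : 0 ≤ E₀ := kineticEnergy_nonneg (u 0)
  refine ⟨C' ^ 2 * (2 * E₀), by positivity, ?_⟩
  have hwin : ∀ᶠ t in 𝓝[<] T, t ∈ Ioo 0 T := Ioo_mem_nhdsLT hT
  filter_upwards [hC, hwin] with t ht htI
  have hTt : 0 < T - t := sub_pos.2 htI.2
  have hsq : 0 < Real.sqrt (T - t) := Real.sqrt_pos.2 hTt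
  have hmem : MemLp (u t) 2 volume := hLH.memLp t ⟨htI.1.le, htI.2.le⟩
  have hint2 : Integrable (fun x => ‖u t x‖ ^ 2) volume :=
    (memLp_two_iff_integrable_sq_norm hmem.1).1 hmem
  -- pointwise: `‖u‖⁴ ≤ (C'²/(T−t)) ‖u‖²`
  have hpt : ∀ x, ‖u t x‖ ^ 4 ≤ C' ^ 2 / (T - t) * ‖u t x‖ ^ 2 := by
    intro x
    have h1 : ‖u t x‖ ≤ C' / Real.sqrt (T - t) :=
      (ht x).trans (div_le_div_of_nonneg_right (le_max_left _ _) hsq.le)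
    have h0 : 0 ≤ ‖u t x‖ := norm_nonneg _
    have h2 : ‖u t x‖ ^ 2 ≤ (C' / Real.sqrt (T - t)) ^ 2 := pow_le_pow_left₀ h0 h1 2
    have h3 : (C' / Real.sqrt (T - t)) ^ 2 = C' ^ 2 / (T - t) := by
      rw [div_pow, Real.sq_sqrt hTt.le]
    calc ‖u t x‖ ^ 4 = ‖u t x‖ ^ 2 * ‖u t x‖ ^ 2 := by ring
      _ ≤ (C' / Real.sqrt (T - t)) ^ 2 * ‖u t x‖ ^ 2 :=
          mul_le_mul_of_nonneg_right h2 (sq_nonneg _)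
      _ = C' ^ 2 / (T - t) * ‖u t x‖ ^ 2 := by rw [h3]
  have hle : ∫ x, ‖u t x‖ ^ 4 ≤ ∫ x, C' ^ 2 / (T - t) * ‖u t x‖ ^ 2 :=
    integral_mono_of_nonneg (Eventually.of_forall fun x => by positivity) (hint2.const_mul _)
      (Eventually.of_forall hpt)
  have hEt : ∫ x, ‖u t x‖ ^ 2 = 2 * VectorCalculus.kineticEnergy (u t) := by
    simp only [VectorCalculus.kineticEnergy]; ring
  have hanti := CertifiedBlowupAxisymBlowup.EnergyDrain.kineticEnergy_antitoneOn hν hcl hLH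
    ⟨le_rfl, hT.le⟩ ⟨htI.1.le, htI.2.le⟩ htI.1.le
  calc ∫ x, ‖u t x‖ ^ 4 ≤ ∫ x, C' ^ 2 / (T - t) * ‖u t x‖ ^ 2 := hle
    _ = C' ^ 2 / (T - t) * (2 * VectorCalculus.kineticEnergy (u t)) := by
        rw [integral_const_mul, hEt]
    _ ≤ C' ^ 2 / (T - t) * (2 * E₀) := by
        refine mul_le_mul_of_nonneg_left ?_ (by positivity)
        simp only [hE₀] at hanti ⊢
        linarith
    _ = C' ^ 2 * (2 * E₀) / (T - t) := by ring

-- Type-I blow-up has no energy jump — RE-DERIVED from the weak-`L⁴` theorem: the statement of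
-- `tendsto_integral_norm_sub_sq_of_isTypeIBlowup` (p639359, rev 5) as an `example` (no new
-- declaration), certifying that the `L⁴` slice-test criterion CONTAINS the Type-I energy equality
-- of Leslie–Shvydkoy 2018 Thm. 1.2 at a first blow-up time.
example {ν T : ℝ} (hν : 0 < ν) (hT : 0 < T)
    {u : ℝ → EuclideanSpace ℝ (Fin 3) → EuclideanSpace ℝ (Fin 3)} {p : ℝ → EuclideanSpace ℝ (Fin 3) → ℝ}
    (hcl : IsClassicalNSSolutionOn (Ico 0 T) ν 0 u p) (hLH : IsLerayHopfOn T ν 0 (u 0) u)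
    (hdec : HasRapidSpatialDecay (u 0)) (hTI : IsTypeIBlowup u T) :
    Tendsto (fun t => ∫ x, ‖u t x - u T x‖ ^ 2) (𝓝[<] T) (𝓝 0) := by
  obtain ⟨M, -, hrate⟩ := weakL4Rate_of_isTypeIBlowup hν hT hcl hLH hTI
  exact tendsto_integral_norm_sub_sq_of_weakL4Rate hν hT hcl hLH hdec hrate

/-! ### Position for the skeleton: stub 3 lives at `L⁴`-HEAVY first blow-ups -/

/-- **`TypeIIEnergyEquality ⟺ EnergyEqualityAtL4HeavyBlowup`.** The statement of the former stub
`stub_typeIIEnergyEquality` of `Cruxes/NoTerminalJolt/Lines/regular_split.lean` (⟺ stub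
`stub_noFastEnergyConcentration` = stmt-18118, rev 7) — «a non-Type-I first blow-up in the frame has
no energy jump at `T`» — is equivalent to the same statement restricted to first blow-ups which are
moreover `L⁴`-HEAVY: for NO `M ≥ 0` does `∫‖u(t)‖⁴ ≤ M/(T−t)` hold near `T` (the weak-`L⁴` case is the
theorem `tendsto_eLpNorm_sub_of_weakL4Rate`). So stub 3 lives exactly at first blow-ups carrying
MORE THAN THE SQUARE of the self-similar `L⁴` mass along a sequence of times. Both sides are OPEN
statements; nothing is asserted about them. [folklore] -/
theorem typeIIEnergyEquality_iff_l4Heavy :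
    (∀ (ν T : ℝ), 0 < ν → 0 < T →
      ∀ (u : ℝ → EuclideanSpace ℝ (Fin 3) → EuclideanSpace ℝ (Fin 3))
        (p : ℝ → EuclideanSpace ℝ (Fin 3) → ℝ),
        Literature.Analysis.FluidPDE.IsMaximalSmoothSolution ν 0 u p T →
        Literature.Analysis.FluidPDE.IsLerayHopfOn T ν 0 (u 0) u →
        Literature.Analysis.FluidPDE.HasRapidSpatialDecay (u 0) →
        ¬ Literature.Analysis.FluidPDE.IsTypeIBlowup u T →
        Filter.Tendsto (fun t => MeasureTheory.eLpNorm (u t - u T) 2 MeasureTheory.volume)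
          (nhdsWithin T (Set.Iio T)) (nhds 0)) ↔
    (∀ (ν T : ℝ), 0 < ν → 0 < T →
      ∀ (u : ℝ → EuclideanSpace ℝ (Fin 3) → EuclideanSpace ℝ (Fin 3))
        (p : ℝ → EuclideanSpace ℝ (Fin 3) → ℝ),
        Literature.Analysis.FluidPDE.IsMaximalSmoothSolution ν 0 u p T →
        Literature.Analysis.FluidPDE.IsLerayHopfOn T ν 0 (u 0) u →
        Literature.Analysis.FluidPDE.HasRapidSpatialDecay (u 0) →
        ¬ Literature.Analysis.FluidPDE.IsTypeIBlowup u T →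
        (∀ M : ℝ, 0 ≤ M → ¬ ∀ᶠ t in nhdsWithin T (Set.Iio T), ∫ x, ‖u t x‖ ^ 4 ≤ M / (T - t)) →
        Filter.Tendsto (fun t => MeasureTheory.eLpNorm (u t - u T) 2 MeasureTheory.volume)
          (nhdsWithin T (Set.Iio T)) (nhds 0)) := by
  refine ⟨fun h ν T hν hT u p hmax hLH hdec hnI _ => h ν T hν hT u p hmax hLH hdec hnI,
    fun h ν T hν hT u p hmax hLH hdec hnI => ?_⟩
  by_cases hmild : ∃ M : ℝ, 0 ≤ M ∧ ∀ᶠ t in nhdsWithin T (Set.Iio T), ∫ x, ‖u t x‖ ^ 4 ≤ M / (T - t)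
  · obtain ⟨M, -, hrate⟩ := hmild
    exact tendsto_eLpNorm_sub_of_weakL4Rate hν hT hmax.1 hLH hdec hrate
  · exact h ν T hν hT u p hmax hLH hdec hnI fun M hM hev => hmild ⟨M, hM, hev⟩

end NoTerminalJolt

end Summit.NavierStokesRegularity.NavierStokesRegularity.Theorems

end
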